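import Literature.Analysis.FluidPDE.SlabTypeICompactnessSharp
import Literature.Analysis.FluidPDE.TsaiTopSingularNullHolds
import HarnessLib

/-!
# Route `AxisTwistDoor`, crux `AveragedConeLiouville` (stmt-NavierStokesRegularity-26889) — INPUT N3 (`ShellFact` by the
# compactness–contradiction route), piece S1: THE LID SINGULAR SET OF A SLAB MEMBER WITH `𝐈 < ∞` IS `𝒫¹`-NULL

N3 cut of record (pub/ns-inputs STATUS 2026-08-28T12:41:44Z, texts OK 12:52:02Z; `kits/N3-skeleton.lean` 815f0a7c119d2985,
`Sig.lidNull`).  BY NAME from Tsai's top-slice partial regularity (plan g6's remark r1): after the unit-ball-mean normalisation of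
the pressure (`IsSuitableWeakSolutionOn.sub_unitBallMean_slab`, `typeIBound_sub_unitBallMean` — backward singularity is
pressure-blind) a slab member with `𝐈 < ∞` is a suitable weak solution in every parabolic ball `Q((0,0),R)`, `R ≥ 1`
(`isSuitableWeakSolutionInBall_of_slab`), whose four conjuncts are the four hypotheses of
`tsai1998_top_singular_null_holds` (`ν = 1`, `T = 0`, `x₀ = 0`): the backward-singular lid points in `B(0,R)` are `μH[1]`-null;
a countable union over `R = 1, 2, 3, …` and the slice conversion «`μH[1]`-null `A ⊂ ℝ³` ⇒ `{T} × A` is `𝒫¹`-null» (a cover of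
`A` by sets of diameters `dᵢ`, `∑ dᵢ < γ`, gives the cylinders `Q*_{dᵢ + ηᵢ}((T,xᵢ))`) finish.

* `isParabolicNull_slice` — `μH[1] A = 0 ⇒ IsParabolicNull 1 {z | z.1 = T ∧ z.2 ∈ A}`;
* **`lidNull`** — the piece (`Sig.lidNull` verbatim).

No NS statement is proved; N3 is an INPUT toward `ShellFact`; item 26889 and the summit stay OPEN.
`--supports stmt-NavierStokesRegularity-26889 --as helper`.
[cite: Tsai1998, remark after Lemma 4.2 (p. 46)] [cite: CaffarelliKohnNirenberg1982, (2.6) and Theorem B]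
-/

noncomputable section

-- the summit and its single sub-problem share the name (CONVENTIONS §1)
set_option linter.dupNamespace false

open MeasureTheory Set Function Metric Filter Topology
open scoped NNReal ENNReal

namespace Summit.NavierStokesRegularity.NavierStokesRegularity.Theorems.AveragedConeLiouville.Shell

open Literature.Analysis Literature.Analysis.FluidPDE

/-! ### Slice conversion: `μH[1]`-null in space ⇒ `𝒫¹`-null on a time slice -/

/-- **A `μH[1]`-null spatial set placed on one time slice is `𝒫¹`-null**: a cover of `A` by sets of diameters `dᵢ ≤ γ`,
`∑ dᵢ < γ` (from `μH[1] A = 0`), gives the cover of `{T} × A` by the centred parabolic cylinders `Q*_{dᵢ + ηᵢ}((T, xᵢ))`,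
`xᵢ ∈ tᵢ`, `∑ ηᵢ = γ`, of total radius `< 2γ`. [cite: CaffarelliKohnNirenberg1982, (2.6)] -/
theorem isParabolicNull_slice {A : Set (EuclideanSpace ℝ (Fin 3))} (hA : μH[1] A = 0) (T : ℝ) :
    IsParabolicNull 1 {z : ℝ × EuclideanSpace ℝ (Fin 3) | z.1 = T ∧ z.2 ∈ A} := by
  classical
  unfold IsParabolicNull parabolicHausdorff
  refine le_antisymm (iSup₂_le fun δ hδ => ?_) bot_le
  refine ENNReal.le_of_forall_pos_le_add fun ε hε _ => ?_
  rw [zero_add]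
  -- a small parameter `γ`
  obtain ⟨γ, hγ⟩ : ∃ x : ℝ, x = min ((ε : ℝ) / 4) (δ / 8) := ⟨_, rfl⟩
  have hε0 : (0 : ℝ) < ε := NNReal.coe_pos.2 hε
  have hγ0 : 0 < γ := by rw [hγ]; exact lt_min (by positivity) (by positivity)
  have hγε : 2 * γ ≤ (ε : ℝ) := by rw [hγ]; linarith [min_le_left ((ε : ℝ) / 4) (δ / 8)]
  have hγδ : 2 * γ < δ := by rw [hγ]; linarith [min_le_right ((ε : ℝ) / 4) (δ / 8)]
  -- a cover of `A` with diameters `≤ γ` and `∑ diam < γ`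
  have hinf : (⨅ (t : ℕ → Set (EuclideanSpace ℝ (Fin 3))) (_ : A ⊆ ⋃ n, t n) (_ : ∀ n, ediam (t n) ≤ ENNReal.ofReal γ),
      ∑' n, ⨆ _ : (t n).Nonempty, ediam (t n) ^ (1 : ℝ)) = 0 := by
    have h := hA
    rw [Measure.hausdorffMeasure_apply] at h
    refine le_antisymm ?_ bot_le
    rw [← h]
    exact le_iSup₂ (f := fun (r : ℝ≥0∞) (_ : 0 < r) =>
      ⨅ (t : ℕ → Set (EuclideanSpace ℝ (Fin 3))) (_ : A ⊆ ⋃ n, t n) (_ : ∀ n, ediam (t n) ≤ r),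
        ∑' n, ⨆ _ : (t n).Nonempty, ediam (t n) ^ (1 : ℝ)) (ENNReal.ofReal γ) (ENNReal.ofReal_pos.2 hγ0)
  have hlt : (⨅ (t : ℕ → Set (EuclideanSpace ℝ (Fin 3))) (_ : A ⊆ ⋃ n, t n) (_ : ∀ n, ediam (t n) ≤ ENNReal.ofReal γ),
      ∑' n, ⨆ _ : (t n).Nonempty, ediam (t n) ^ (1 : ℝ)) < ENNReal.ofReal γ := by
    rw [hinf]; exact ENNReal.ofReal_pos.2 hγ0
  rw [iInf_lt_iff] at hlt
  obtain ⟨t, ht⟩ := hlt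
  rw [iInf_lt_iff] at ht
  obtain ⟨hcov, ht'⟩ := ht
  rw [iInf_lt_iff] at ht'
  obtain ⟨hdiam, hsum⟩ := ht'
  -- centres and radii
  obtain ⟨η, hη⟩ : ∃ η : ℕ → ℝ, ∀ n, η n = γ / 2 / 2 ^ n := ⟨_, fun _ => rfl⟩
  have hη0 : ∀ n, 0 < η n := fun n => by rw [hη]; positivity
  have hηγ : ∀ n, η n ≤ γ / 2 := fun n => by
    rw [hη, div_le_iff₀ (by positivity)]
    have : (1 : ℝ) ≤ 2 ^ n := one_le_pow₀ (by norm_num)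
    nlinarith
  have hηsum : ∑' n, η n = γ := by simp_rw [hη]; exact tsum_geometric_two' γ
  have hηsumm : Summable η := by
    have e : η = fun n => γ / 2 / 2 ^ n := funext hη
    rw [e]; exact summable_geometric_two' γ
  obtain ⟨x, hx⟩ : ∃ x : ℕ → EuclideanSpace ℝ (Fin 3), ∀ n, x n = if h : (t n).Nonempty then h.some else 0 :=
    ⟨_, fun _ => rfl⟩
  obtain ⟨ρ, hρ⟩ : ∃ ρ : ℕ → ℝ, ∀ n, ρ n = (if (t n).Nonempty then (ediam (t n)).toReal else 0) + η n :=
    ⟨_, fun _ => rfl⟩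
  have hdiamR : ∀ n, (ediam (t n)).toReal ≤ γ := fun n =>
    ENNReal.toReal_le_of_le_ofReal hγ0.le (hdiam n)
  have hρ0 : ∀ n, 0 < ρ n := fun n => by
    rw [hρ]
    split_ifs
    · exact add_pos_of_nonneg_of_pos ENNReal.toReal_nonneg (hη0 n)
    · rw [zero_add]; exact hη0 n
  have hρδ : ∀ n, ρ n < δ := fun n => by
    rw [hρ]
    have h1 : (if (t n).Nonempty then (ediam (t n)).toReal else 0) ≤ γ := by
      split_ifs
      · exact hdiamR n
      · exact hγ0.le
    linarith [hηγ n, h1]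
  -- the cover
  have hcover : {z : ℝ × EuclideanSpace ℝ (Fin 3) | z.1 = T ∧ z.2 ∈ A} ⊆
      ⋃ n, parabolicCylinderCentered (ρ n) ((T, x n) : ℝ × EuclideanSpace ℝ (Fin 3)) := by
    rintro z ⟨hz1, hz2⟩
    obtain ⟨n, hn⟩ := mem_iUnion.1 (hcov hz2)
    refine mem_iUnion.2 ⟨n, ?_⟩
    have hne : (t n).Nonempty := ⟨z.2, hn⟩
    have hxn : x n ∈ t n := by rw [hx, dif_pos hne]; exact hne.some_mem
    have hdist : dist z.2 (x n) < ρ n := by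
      have h1 : edist z.2 (x n) ≤ ediam (t n) := edist_le_ediam_of_mem hn hxn
      have h2 : ediam (t n) ≠ ⊤ := ne_top_of_le_ne_top ENNReal.ofReal_ne_top (hdiam n)
      have h3 : dist z.2 (x n) ≤ (ediam (t n)).toReal := by
        rw [dist_edist]; exact ENNReal.toReal_mono h2 h1
      rw [hρ, if_pos hne]
      linarith [hη0 n]
    refine ⟨⟨?_, ?_⟩, mem_ball.2 hdist⟩
    · show (T, x n).1 - ρ n ^ 2 < z.1
      rw [hz1]; simp only; nlinarith [hρ0 n]
    · show z.1 < (T, x n).1 + ρ n ^ 2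
      rw [hz1]; simp only; nlinarith [hρ0 n]
  -- the parabolic `δ`-content is at most `∑ ρₙ ≤ 2γ ≤ ε`
  have hcontent : parabolicHausdorffContent 1 δ {z : ℝ × EuclideanSpace ℝ (Fin 3) | z.1 = T ∧ z.2 ∈ A} ≤
      ∑' n, ENNReal.ofReal (ρ n ^ (1 : ℝ)) := by
    unfold parabolicHausdorffContent
    refine iInf_le_of_le (fun n => ((T, x n) : ℝ × EuclideanSpace ℝ (Fin 3))) ?_
    refine iInf_le_of_le ρ ?_
    refine iInf_le_of_le (fun n => ⟨(hρ0 n).le, hρδ n⟩) ?_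
    exact iInf_le_of_le hcover le_rfl
  refine hcontent.trans ?_
  · -- the sum
    have hterm : ∀ n, ENNReal.ofReal (ρ n ^ (1 : ℝ)) ≤ (⨆ _ : (t n).Nonempty, ediam (t n) ^ (1 : ℝ)) + ENNReal.ofReal (η n) := by
      intro n
      rw [Real.rpow_one, hρ]
      by_cases hne : (t n).Nonempty
      · rw [if_pos hne, ciSup_pos hne, ENNReal.rpow_one, ENNReal.ofReal_add ENNReal.toReal_nonneg (hη0 n).le]
        exact add_le_add ENNReal.ofReal_toReal_le le_rfl
      · rw [if_neg hne, zero_add]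
        exact le_add_self
    calc ∑' n, ENNReal.ofReal (ρ n ^ (1 : ℝ))
        ≤ ∑' n, ((⨆ _ : (t n).Nonempty, ediam (t n) ^ (1 : ℝ)) + ENNReal.ofReal (η n)) := ENNReal.tsum_le_tsum hterm
      _ = (∑' n, ⨆ _ : (t n).Nonempty, ediam (t n) ^ (1 : ℝ)) + ∑' n, ENNReal.ofReal (η n) := ENNReal.tsum_add
      _ ≤ ENNReal.ofReal γ + ENNReal.ofReal γ := by
          refine add_le_add hsum.le (le_of_eq ?_)
          rw [← ENNReal.ofReal_tsum_of_nonneg (fun n => (hη0 n).le) hηsumm, hηsum]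
      _ = ENNReal.ofReal (2 * γ) := by rw [← ENNReal.ofReal_add hγ0.le hγ0.le]; ring_nf
      _ ≤ (ε : ℝ≥0∞) := by
          rw [← ENNReal.ofReal_coe_nnreal]; exact ENNReal.ofReal_le_ofReal hγε

/-! ### The piece -/

/-- **S1 `stub_lidNull` of the N3 skeleton (`Sig.lidNull` verbatim).** For a suitable weak solution on the backward slab with a weak
spatial gradient and `𝐈 < ∞`, the backward-singular points of the lid `{t = 0}` form a `𝒫¹`-null set (Tsai's top-slice partial
regularity in every `Q((0,0),R)` after the pressure normalisation, union over `R ∈ ℕ`, slice conversion).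
[cite: Tsai1998, remark after Lemma 4.2 (p. 46)] -/
theorem lidNull :
    ∀ (u : ℝ → EuclideanSpace ℝ (Fin 3) → EuclideanSpace ℝ (Fin 3)) (p : ℝ → EuclideanSpace ℝ (Fin 3) → ℝ)
      (H : ℝ → EuclideanSpace ℝ (Fin 3) → EuclideanSpace ℝ (Fin 3) →L[ℝ] EuclideanSpace ℝ (Fin 3)),
      IsSuitableWeakSolutionOn (slab (EuclideanSpace ℝ (Fin 3)) (Iio (0 : ℝ)) isOpen_Iio) 1 0 u p →
      HasWeakSpatialGradientOn (slab (EuclideanSpace ℝ (Fin 3)) (Iio (0 : ℝ)) isOpen_Iio) u H →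
      typeIBound (Iio (0 : ℝ) ×ˢ (univ : Set (EuclideanSpace ℝ (Fin 3)))) u p H < ⊤ →
      IsParabolicNull 1 {z : ℝ × EuclideanSpace ℝ (Fin 3) | z.1 = 0 ∧ IsBackwardSingularPoint u z} := by
  intro u p H hsw hwg hI
  -- pressure normalisation (backward singularity is pressure-blind)
  set pn : ℝ → EuclideanSpace ℝ (Fin 3) → ℝ := fun t x => p t x - ⨍ y in ball (0 : EuclideanSpace ℝ (Fin 3)) 1, p t y with hpn
  have hswn : IsSuitableWeakSolutionOn (slab (EuclideanSpace ℝ (Fin 3)) (Iio (0 : ℝ)) isOpen_Iio) 1 0 u pn :=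
    hsw.sub_unitBallMean_slab
  have hIn : typeIBound (Iio (0 : ℝ) ×ˢ (univ : Set (EuclideanSpace ℝ (Fin 3)))) u pn H ≠ ⊤ := by
    have h := typeIBound_sub_unitBallMean (u := u) (G := H) hsw.distributional.2.2.1
    rw [hpn, h]
    exact hI.ne
  have h0 : ∀ t, ⨍ y in ball (0 : EuclideanSpace ℝ (Fin 3)) 1, pn t y = 0 := fun t => unitBallMean_sub_unitBallMean p t
  -- the backward-singular lid points, ball by ball
  have hball : ∀ n : ℕ, μH[1] {x : EuclideanSpace ℝ (Fin 3) | x ∈ ball (0 : EuclideanSpace ℝ (Fin 3)) ((n : ℝ) + 1) ∧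
      IsBackwardSingularPoint u ((0 : ℝ), x)} = 0 := by
    intro n
    have hR : (1 : ℝ) ≤ (n : ℝ) + 1 := by have : (0 : ℝ) ≤ n := Nat.cast_nonneg n; linarith
    have hR0 : (0 : ℝ) < (n : ℝ) + 1 := by linarith
    obtain ⟨hs, hen, hgr, hpr⟩ := isSuitableWeakSolutionInBall_of_slab hswn hwg hIn h0 hR
    obtain ⟨h32, h32', h32r⟩ := threeHalves_facts
    have hplt : ∫⁻ z in parabolicCylinder ((n : ℝ) + 1) ((0 : ℝ), (0 : EuclideanSpace ℝ (Fin 3))),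
        ‖pn z.1 z.2‖ₑ ^ (3 / 2 : ℝ) < ∞ := by
      have h1 := lintegral_rpow_enorm_lt_top_of_eLpNorm_lt_top (zero_lt_one.trans_le h32).ne' h32' hpr.eLpNorm_lt_top
      rw [h32r] at h1
      exact h1
    have hen' : ∃ C : ℝ≥0, ∀ᵐ t : ℝ, t ∈ Ioo ((0 : ℝ) - ((n : ℝ) + 1) ^ 2) 0 →
        ∫⁻ x in ball (0 : EuclideanSpace ℝ (Fin 3)) ((n : ℝ) + 1), ‖u t x‖ₑ ^ 2 ≤ C := by
      obtain ⟨C, hC⟩ := hen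
      exact ⟨C, (ae_restrict_iff' measurableSet_Ioo).1 hC⟩
    exact tsai1998_top_singular_null_holds one_pos hR0 hs hen' hgr hplt
  -- union over the balls
  have hall : μH[1] {x : EuclideanSpace ℝ (Fin 3) | IsBackwardSingularPoint u ((0 : ℝ), x)} = 0 := by
    have hsub : {x : EuclideanSpace ℝ (Fin 3) | IsBackwardSingularPoint u ((0 : ℝ), x)} ⊆
        ⋃ n : ℕ, {x : EuclideanSpace ℝ (Fin 3) | x ∈ ball (0 : EuclideanSpace ℝ (Fin 3)) ((n : ℝ) + 1) ∧
          IsBackwardSingularPoint u ((0 : ℝ), x)} := by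
      intro x hx
      obtain ⟨n, hn⟩ := exists_nat_gt ‖x‖
      exact mem_iUnion.2 ⟨n, ⟨mem_ball_zero_iff.2 (by linarith), hx⟩⟩
    exact measure_mono_null hsub (measure_iUnion_null hball)
  -- slice conversion
  have h := isParabolicNull_slice hall 0
  refine h.mono ?_
  rintro z ⟨hz1, hz2⟩
  refine ⟨hz1, ?_⟩
  show IsBackwardSingularPoint u ((0 : ℝ), z.2)
  have e : z = ((0 : ℝ), z.2) := by rw [← hz1]
  rw [← e]
  exact hz2

end Summit.NavierStokesRegularity.NavierStokesRegularity.Theorems.AveragedConeLiouville.Shell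

end
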